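import Mathlib.Geometry.Manifold.Diffeomorph
import Mathlib.Geometry.Manifold.Instances.Real
import Literature.Topology.FourManifolds.PLManifold
import HarnessLib

-- provenance: harness21/H21/H21/Statements/SPC4/PLStructures.lean @ 10323c8 (interim HEAD d8f2665); M5 mechanical rewrite
/-!
# PL = DIFF in dimension 4 (family `spc4`, statement `spc4.S35`)

Family `spc4` of the H21 statement library, trunk G24 `FourManL`. This file states the
classical smoothing theory of PL manifolds specialised to dimension `4`, as two named facts
(`def … : Prop`, D-0014) and one specialisation:

* **spc4.S35** (existence, `exists_isManifold_isWhiteheadCompatible_four`): every PL 4-manifold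
  `(M, cPL)` carries a smooth structure `cDIFF` on the same topological space which is
  *Whitehead compatible* with `cPL` (the PL structure is a smooth triangulation of the smooth
  structure);
* **spc4.S35** (uniqueness, `nonempty_diffeomorph_of_isWhiteheadCompatible_four`): two smooth
  structures on `M` both Whitehead compatible with the same PL structure are diffeomorphic;
* Whitehead's converse (every smooth 4-manifold has a compatible PL structure), a one-line
  specialisation of the named fact `Literature.Topology.FourManifolds.exists_isPLManifold_isWhiteheadCompatible` of
  `Literature.Topology.FourManifolds.PLManifold`, taken as the hypothesis `h`.

Sources: J. Cerf, *Sur les difféomorphismes de la sphère de dimension trois (Γ₄ = 0)*, LNM 53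
(1968); M. Hirsch – B. Mazur, *Smoothings of piecewise linear manifolds*, Ann. of Math. Studies 80
(1974), Part II; R. Kirby – L. Siebenmann, *Foundational essays on topological manifolds,
smoothings, and triangulations*, Ann. of Math. Studies 88 (1977), Essay V; J.H.C. Whitehead,
*On C¹-complexes*, Ann. of Math. 41 (1940).

## Remarks

* By Hirsch–Mazur and Kirby–Siebenmann, smoothings of a PL `n`-manifold are classified by lifts
  of the PL tangent bundle `M → BPL` to `BO`, with fibre `PL/O`; since `PL/O` is `6`-connected
  (Cerf's `Γ₄ = 0` together with Kervaire–Milnor), *existence* of a compatible smoothing holds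
  for all `n ≤ 7` and *uniqueness* (up to diffeomorphism, indeed up to concordance/isotopy) for
  all `n ≤ 6`. We state only dimension `4`, as the inventory does. The smoothing classification
  theorem is printed in Hirsch–Mazur (Part II) and Kirby–Siebenmann (Essay V); Cerf 1968 supplies
  the input `Γ₄ = 0` and is kept as a second tag.
* This is the PL/DIFF side. On the TOP side in dimension `4`, PL (equivalently smooth) structures
  on a topological 4-manifold need neither exist (Freedman's `E₈` manifold) nor be unique
  (exotic `ℝ⁴`'s; Donaldson); those are the Kirby–Siebenmann / exotic-structure statements of the
  family and are not restated here.

## Mathlib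

Mathlib has `IsManifold`, `Diffeomorph`, `ChartedSpace`, `Structomorph` (all used) and no PL
manifolds; the PL notions come from `Literature.Topology.FourManifolds.PLManifold`
(`IsPLManifold`, `IsWhiteheadCompatible`), whose PL groupoid is built relative to the two named
facts `IsPLOn.comp` and `isPLOn_affineMap`; as there, they are threaded here as the explicit
hypotheses `hcomp haff`.

## Design

As in the accepted `Literature.Topology.FourManifolds.SPC4Wave0` (`spc4.S33`) and in
`PLManifold`, "two structures on the same topological manifold" are two `ChartedSpace (𝔼 4) M`
structures on a fixed topological space `M`; smoothness of a non-instance atlas `c` is written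
`@IsManifold ℝ _ _ _ _ _ _ (𝓡 4) ∞ M _ c` and the diffeomorphism type between `(M, c₁)` and
`(M, c₂)` is written with `@Diffeomorph`, supplying the two atlases explicitly.
-/

open scoped Manifold ContDiff Topology

noncomputable section

namespace Literature.Topology.FourManifolds

section SPC4

local notation "𝔼 " n:arg => EuclideanSpace ℝ (Fin n)

universe u

variable (hcomp : IsPLOn.comp (n := 4)) (haff : isPLOn_affineMap (n := 4) (m := 4))

/-- **spc4.S35** (PL = DIFF in dimension 4, existence; Hirsch–Mazur 1974, Part II;
Kirby–Siebenmann 1977, Essay V; input Cerf 1968, `Γ₄ = 0`). Every PL 4-manifold has a compatible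
smooth structure: for every Hausdorff second-countable topological space `M` with a PL atlas `cPL`
modelled on `ℝ⁴` (PL relative to the hypotheses `hcomp haff` of `plGroupoid`), there is a `C^∞`
atlas `cDIFF` on the same space `M` such that `cPL` is Whitehead compatible with `cDIFF` (the
identity `M_PL → M_DIFF` is piecewise differentiable of maximal rank in charts, i.e. `cPL` is a
smooth triangulation of `(M, cDIFF)`). More generally this holds for PL `n`-manifolds with
`n ≤ 7`, since `PL/O` is `6`-connected. Named fact (statement only); users take
`(h : exists_isManifold_isWhiteheadCompatible_four hcomp haff)`.
[cite: HirschMazur1974, Part II (smoothing classification theorem)] [cite: KirbySiebenmann1977, Essay V] [cite: Cerf1968, Γ₄ = 0] -/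
def exists_isManifold_isWhiteheadCompatible_four : Prop :=
  ∀ (M : Type u) [TopologicalSpace M] [T2Space M] [SecondCountableTopology M]
    [cPL : ChartedSpace (𝔼 4) M] [IsPLManifold 4 hcomp haff M],
    ∃ cDIFF : ChartedSpace (𝔼 4) M,
      @IsManifold ℝ _ _ _ _ _ _ (𝓡 4) ∞ M _ cDIFF ∧ IsWhiteheadCompatible 4 M cPL cDIFF

/-- **spc4.S35** (PL = DIFF in dimension 4, uniqueness; Hirsch–Mazur 1974, Part II;
Kirby–Siebenmann 1977, Essay V; input Cerf 1968, `Γ₄ = 0`). The compatible smooth structure of a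
PL 4-manifold is unique up to diffeomorphism: if `c₁` and `c₂` are two `C^∞` atlases modelled on
`ℝ⁴` on the Hausdorff second-countable topological space `M`, both Whitehead compatible with the
same PL structure `cPL` (PL relative to `hcomp haff`), then the smooth manifolds `(M, c₁)` and
`(M, c₂)` are diffeomorphic. More generally this holds for PL `n`-manifolds with `n ≤ 6`, since
`PL/O` is `6`-connected. Named fact (statement only); users take
`(h : nonempty_diffeomorph_of_isWhiteheadCompatible_four hcomp haff)`.
[cite: HirschMazur1974, Part II (smoothing classification theorem)] [cite: KirbySiebenmann1977, Essay V] [cite: Cerf1968, Γ₄ = 0] -/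
def nonempty_diffeomorph_of_isWhiteheadCompatible_four : Prop :=
  ∀ (M : Type u) [TopologicalSpace M] [T2Space M] [SecondCountableTopology M]
    [cPL : ChartedSpace (𝔼 4) M] [IsPLManifold 4 hcomp haff M]
    (c₁ c₂ : ChartedSpace (𝔼 4) M) (_h₁ : @IsManifold ℝ _ _ _ _ _ _ (𝓡 4) ∞ M _ c₁)
    (_h₂ : @IsManifold ℝ _ _ _ _ _ _ (𝓡 4) ∞ M _ c₂) (_w₁ : IsWhiteheadCompatible 4 M cPL c₁)
    (_w₂ : IsWhiteheadCompatible 4 M cPL c₂),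
    Nonempty
      (@Diffeomorph ℝ _ (𝔼 4) _ _ (𝔼 4) _ _ (𝔼 4) _ (𝔼 4) _ (𝓡 4) (𝓡 4) M _ c₁ M _ c₂ ∞)

/-- Whitehead's converse in dimension 4 (J.H.C. Whitehead, *On C¹-complexes*, Ann. of Math. 41
(1940), Thm 7; Munkres, *Elementary differential topology* (1966), Thm 10.6): every smooth
4-manifold `(M, cDIFF)` (Hausdorff, second countable) admits a PL structure `cPL` on the same
topological space (PL relative to `hcomp haff`) which is Whitehead compatible with `cDIFF`, i.e. a
smooth triangulation. Specialisation to `n = 4` of the named fact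
`Literature.Topology.FourManifolds.exists_isPLManifold_isWhiteheadCompatible` of `PLManifold`, taken as the hypothesis `h`. [folklore] -/
theorem exists_isPLManifold_isWhiteheadCompatible_four
    (h : exists_isPLManifold_isWhiteheadCompatible.{u} 4 hcomp haff) (M : Type u)
    [TopologicalSpace M] [T2Space M] [SecondCountableTopology M] [cDIFF : ChartedSpace (𝔼 4) M]
    [IsManifold (𝓡 4) ∞ M] :
    ∃ cPL : ChartedSpace (𝔼 4) M,
      @IsPLManifold 4 hcomp haff M _ cPL ∧ IsWhiteheadCompatible 4 M cPL cDIFF :=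
  h M

end SPC4

end Literature.Topology.FourManifolds
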